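import Summits.BirchSwinnertonDyer.BirchSwinnertonDyer.Theorems.GenusKolyvaginAtTwoGenusPrimitiveSupplyAtTwoPosDiscShallowKFourPosHalvingDescentDepth
import Summits.BirchSwinnertonDyer.BirchSwinnertonDyer.Theorems.GenusKolyvaginAtTwoGenusPrimitiveSupplyAtTwoPosDiscShallowKFourPosHalvingDescentCorollaries
import Summits.BirchSwinnertonDyer.BirchSwinnertonDyer.Theorems.GenusKolyvaginAtTwoGenusPrimitiveSupplyAtTwoPosDiscShallowKFourPosSelmerProfile
import HarnessLib

/-!
# Route `GenusKolyvaginAtTwo`, crux K₄⁺ `K4Pos` (stmt-BirchSwinnertonDyer-31469) — THE FIRST-LAYER DROP OF THE KOLYVAGIN DEPTH IS AT LEAST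
# `e = log₄ #Ш(E/ℚ)[2^∞]`: on the K₄⁺ cut cell (mod Q2) some transposition-deep Kolyvagin prime `ℓ` has `P(ℓ) ∉ 2^(M₀+1−e) E(K[ℓ])`;
# unconditionally `P(ℓ) ∉ 2^(M₀) E(K[ℓ])` for some `ℓ` (the depth DROPS at the first layer)

Width seat `bsd-line-gk2-p5` g37 (cell `bsd-f1-sign2`), `--supports stmt-BirchSwinnertonDyer-31469 --as helper`; sequel of g36's FIRST-BLOCK INEQUALITY
(`…KFourPosHalvingDescentDepth`, p771766: a class `s₀ ∈ Sel_(2^M)(E/ℚ)` with `2^(M₀−j)•s₀ ≠ 0` ⟹ a transposition-deep `ℓ` with `P(ℓ) ∉ 2^j E(K[ℓ])`)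
and of this seat's SELMER PROFILE (`…KFourPosSelmerProfile`, p775150: `#Sel_(2^k)(E/ℚ) = 4^(min k e)`, `1 ≤ e ≤ M₀`).  THEOREMS ONLY (no definition, no named
fact, no `sorry`); standard axioms.  **BSD is NOT proved by this file; K4Pos is NOT proved; nothing is closed.**

* §1 `exists_transpositionDeep_notMem_two_pow_of_two_pow_sub_smul_ne_zero` — g36's master first-block inequality with BOTH supplies DISCHARGED on the
  multiplicative cut (`hPair` by `regularPairSupply_of_heegner`, (NPh_K) by `NonPhantomPow.nonPhantomAtTwo_of_hasMultiplicativeReductionAt`) and at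
  EVERY level `M` (lift of `s₀` along the injective change of level): mod Q2, **`s₀ ∈ Sel_(2^M)(E/ℚ)`, `2^(M₀−j)•s₀ ≠ 0`, `j ≥ 1` ⟹ ∃ transposition-deep
  Kolyvagin prime `ℓ` (index `≥ 2`) and a `d₁`-compatible datum with `P(ℓ) ∉ 2^j E(K[ℓ])`.**  Any sign of `Δ`.
* §2 `exists_transpositionDeep_notMem_two_pow_of_selmerProfile` — on gk2-p4 g29's K₄⁺ cut cell frame (mod Q2 only): with the profile's `e`
  (`#Ш(E/ℚ)[2^∞] = 4^e`, `1 ≤ e ≤ M₀`), **some transposition-deep `ℓ` has `P(ℓ) ∉ 2^(M₀+1−e) E(K[ℓ])`** — in Kolyvagin's notation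
  **`M₀ − M₁ ≥ e`: the first invariant `N₁` of the `2`-primary Kolyvagin system is AT LEAST `log₄ #Ш(E/ℚ)[2^∞]`** (the structure theorem at odd `p`
  says `=` for one-block `Ш`; K₄⁺ ⟺ `e = M₀` ⟺ `M₁ = 0` at a transposition-deep prime, this seat's ★★′).
* §3 `exists_transpositionDeep_notMem_two_pow_depth_of_kFourPos_cut` — since `#Sel₂(E) = 4 > 1`: **unconditionally (mod Q2) some transposition-deep
  `ℓ` has `P(ℓ) ∉ 2^(M₀) E(K[ℓ])`** — the Kolyvagin depth DROPS at the first layer on every K₄⁺ cut cell (`M₁ < M₀`).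
BSD is NOT proved by any of this.

References: [McCallumLMS1991] §5 Lemma 5.3, Thm. 5.4, Thm. 5.8; [Kolyvagin1989Izv] Thm. B₂; [Kolyvagin1991MathAnn] Thm. 1; [GrossLMS1991] §5;
[LawsonWuthrich2016] §7.1.
-/

set_option autoImplicit false
-- the Theorems namespace of this sub repeats the summit name by design (D-0017 nested layout)
set_option linter.dupNamespace false

noncomputable section

open scoped Classical
open scoped AddSubgroup

namespace Summit.BirchSwinnertonDyer.BirchSwinnertonDyer.Theorems.GenusExact.PlusDescent

open WeierstrassCurve NumberField IsDedekindDomain Field Rat.HeightOneSpectrum Literature.NumberTheory.EllipticCurves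
  Literature.NumberTheory.GaloisRepresentations Literature.NumberTheory.EllipticCurves.ModularForms AddSubgroup
  Literature.NumberTheory.EllipticCurves.RingClassField
open Literature.NumberTheory.EllipticCurves.KolyvaginCocycle
open Summit.BirchSwinnertonDyer.BirchSwinnertonDyer.Theses.GenusKolyvaginAtTwo (KolyvaginRelationAtTwo)
open Summit.BirchSwinnertonDyer.Rank1Residual
open Summit.BirchSwinnertonDyer.BirchSwinnertonDyer.Theorems.GenusExact
open Summit.BirchSwinnertonDyer.BirchSwinnertonDyer.Theorems.OffBigImageOddLocalAtTwo
open Summit.BirchSwinnertonDyer.BirchSwinnertonDyer.Theorems.GenusExact.ShaCores (mordellWeilRank_eq_zero_and_finite_shaPrimary_rat_of_cut)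

/-! ## §1 The first-block inequality on the multiplicative cut, every level, both supplies discharged (mod Q2) -/

/-- **FIRST-BLOCK INEQUALITY ON THE CUT, mod Q2** (g36's `exists_transpositionDeep_notMem_two_pow_of_two_pow_sub_smul_ne_zero_of_nonPhantom_of_regularPairSupply`
with `hPair` discharged by `regularPairSupply_of_heegner` and (NPh_K) by the multiplicative cut, at every level `M`): non-CM `E/ℚ` globally minimal, odd
Tamagawa product, an odd multiplicative prime `v`, `ρ_{E,2^n}` onto; `K` imaginary quadratic, `d_K` odd `≠ −3`, Heegner, the two B₂ non-squares; `w(E) = +1`;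
`d₁` with `2^(M₀+1) ∤ P(1)`.  **If `s₀ ∈ Sel_(2^M)(E/ℚ)` has `2^(M₀−j)•s₀ ≠ 0` (`j ≥ 1`), there are a transposition-deep Kolyvagin prime `ℓ` (index `≥ 2`,
a Frobenius involution of `E[2]` moving a point and inducing complex conjugation on `K`) and a `d₁`-compatible datum of conductor `1·ℓ` with
`P(1·ℓ) ∉ 2^j E(K[1·ℓ])`.**  Any sign of `Δ`.  BSD is NOT proved by this. [cite: McCallumLMS1991, §5 Lemma 5.3, Thm. 5.4] [cite: Kolyvagin1989Izv, Thm. B₂]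
[cite: LawsonWuthrich2016, §7.1] -/
theorem exists_transpositionDeep_notMem_two_pow_of_two_pow_sub_smul_ne_zero (hQ2 : KolyvaginRelationAtTwo)
    (W : WeierstrassCurve ℚ) [W.IsElliptic] [W.IsGloballyMinimal] [NeZero (W.conductorNorm ℤ)] (hcm : ¬ W.HasCM)
    (hT : Odd W.tamagawaProduct) (v : HeightOneSpectrum (𝓞 ℚ)) (h2v : ((2 : ℕ) : 𝓞 ℚ) ∉ v.asIdeal)
    (hNv : ((W.conductorNorm ℤ : ℕ) : 𝓞 ℚ) ∈ v.asIdeal) (hmult : W.HasMultiplicativeReductionAt v)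
    (K : Type) [Field K] [NumberField K] (hIQ : IsImaginaryQuadratic K) (hodd : Odd (NumberField.discr K))
    (h3 : NumberField.discr K ≠ -3) (hHe : SatisfiesHeegnerHypothesis (W.conductorNorm ℤ) K)
    (hsq1 : ¬ IsSquare ((NumberField.discr K : ℚ) * -|W.Δ|)) (hsq2 : ¬ IsSquare ((NumberField.discr K : ℚ) * (-(2 * |W.Δ|))))
    (hρ : ∀ n : ℕ, 0 < n → W.HasSurjectiveModNGaloisRep ((2 : ℤ) ^ n))
    (Dt : ModularParametrizationData W (W.conductorNorm ℤ)) (β : ℤ) (ι : K →+* ℂ) (d₁ : KolyvaginHeegnerData Dt β ι 1) (M₀ : ℕ)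
    (hndiv : ¬ ∃ Q : (W.baseChange (ringClassField K ι 1)).toAffine.Point, ((2 ^ (M₀ + 1) : ℕ) : ℤ) • Q = d₁.derivedPoint)
    (hw1 : W.rootNumber = 1)
    (M : ℕ) (s₀ : galH1Torsion W ((2 ^ M : ℕ) : ℤ)) (hs₀ : s₀ ∈ selmerGroup W ((2 ^ M : ℕ) : ℤ))
    (j : ℕ) (hj1 : 1 ≤ j) (hne : ((2 ^ (M₀ - j) : ℕ) : ℤ) • s₀ ≠ 0) :
    ∃ (ℓ : ℕ) (d : KolyvaginHeegnerData Dt β ι (1 * ℓ)),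
      Zhang2014.IsKolyvaginPrime (W.conductorNorm ℤ) W K 2 ℓ ∧ 2 ≤ Zhang2014.kolyvaginIndex W 2 ℓ ∧
      (∃ (v : HeightOneSpectrum (𝓞 ℚ)) (𝔓 : Ideal (absIntegers (𝓞 ℚ) ℚ)) (h c₀ : absoluteGaloisGroup ℚ),
          (ℓ : 𝓞 ℚ) ∈ v.asIdeal ∧ 𝔓 ∈ v.primesAbove ∧ IsArithFrobAt (𝓞 ℚ) h 𝔓 ∧ IsComplexConjugation (Rat.castHom ℝ) c₀ ∧
          (∀ X : geomTorsion W ((2 : ℕ) : ℤ), h • h • X = X) ∧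
          (∃ u : geomTorsion W ((2 : ℕ) : ℤ), h • u ≠ u) ∧
          ∀ (e : K →ₐ[ℚ] AlgebraicClosure ℚ) (z : K), h • e z = c₀ • e z) ∧
      (∀ s ∈ d₁.S, ∃ s' ∈ d.S, ∀ (x : ringClassField K ι 1) (x' : ringClassField K ι (1 * ℓ)),
          (x : ℂ) = x' → ((s' x' : ringClassField K ι (1 * ℓ)) : ℂ) = (s x : ℂ)) ∧
      (∀ (x : ringClassField K ι 1) (x' : ringClassField K ι (1 * ℓ)), (x : ℂ) = x' → d.emb x' = d₁.emb x) ∧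
      ¬ ∃ Q : (W.baseChange (ringClassField K ι (1 * ℓ))).toAffine.Point, ((2 ^ j : ℕ) : ℤ) • Q = d.derivedPoint := by
  haveI : Fact (Nat.Prime 2) := ⟨Nat.prime_two⟩
  have hs2 : W.HasSurjectiveModNGaloisRep 2 := by simpa using hρ 1 one_pos
  have hN : (W.conductorNorm ℤ) ≠ 0 := NeZero.ne _
  -- (NPh_K) on the multiplicative cut; the regular signed pair-Čebotarev supply from the Heegner frame
  have hNPh : ∀ (L : ℕ), 1 ≤ L → ∀ z : galH1Torsion (W.baseChange K) ((2 ^ L : ℕ) : ℤ),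
      (∀ ρ' ∈ torsionFixing (W.baseChange K) ((2 ^ L : ℕ) : ℤ), h1Eval (W.baseChange K) ((2 ^ L : ℕ) : ℤ) z ρ' = 0) →
      (∀ w : HeightOneSpectrum (𝓞 K), z ∈ selmerLocalKer (W.baseChange K) (w.adicCompletion K) ((2 ^ L : ℕ) : ℤ)) → z = 0 :=
    fun L hL z hz hzS ↦ NonPhantomPow.nonPhantomAtTwo_of_hasMultiplicativeReductionAt (W := W) (K := K) hT hρ hIQ hodd hsq1 hsq2 hN hHe
      h2v hNv hmult L hL z hz (fun w _ ↦ hzS w)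
  have hPair := regularPairSupply_of_heegner W K hIQ hodd hHe hρ
  -- move `s₀` up to level `2^(M + M₀ + 1) ≥ 2^(M₀ + 1)`
  have hdvd : ((2 ^ M : ℕ) : ℤ) ∣ ((2 ^ (M + M₀ + 1) : ℕ) : ℤ) := natCast_pow_dvd_natCast_pow (p := 2) (by omega)
  have hinj : Function.Injective (torsionH1OfDvd W hdvd) :=
    VisiblePairAtTwo.torsionH1OfDvd_pow_injective W (p := 2) (VisiblePairAtTwo.torsionBy_two_eq_bot_of_surj W hs2) hdvd
  have hs₀' : torsionH1OfDvd W hdvd s₀ ∈ selmerGroup W ((2 ^ (M + M₀ + 1) : ℕ) : ℤ) := torsionH1OfDvd_mem_selmerGroup W hdvd hs₀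
  have hne' : ((2 ^ (M₀ - j) : ℕ) : ℤ) • torsionH1OfDvd W hdvd s₀ ≠ 0 := fun h ↦
    hne (hinj (by rw [map_zsmul, map_zero, h]))
  obtain ⟨ℓ, d, hkol, hidx, ⟨v', 𝔓, h, c₀, hℓv, h𝔓, hh, hc₀, hhsq, hhu, hhK⟩, hS, hemb, hwit⟩ :=
    exists_transpositionDeep_notMem_two_pow_of_two_pow_sub_smul_ne_zero_of_nonPhantom_of_regularPairSupply hQ2 W hcm hT K hIQ hodd h3 hHe hρ
      hNPh Dt β ι d₁ M₀ hndiv hw1 hPair (M + M₀ + 1) (by omega) _ hs₀' j hj1 hne'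
  exact ⟨ℓ, d, hkol, le_trans (by omega) hidx,
    ⟨v', 𝔓, h, c₀, hℓv, h𝔓, hh, hc₀,
      smul_smul_eq_self_of_dvd W (by exact_mod_cast dvd_pow_self 2 (by omega : M + M₀ + 1 + j + 1 ≠ 0)) hhsq, hhu, hhK⟩,
    hS, hemb, hwit⟩

/-! ## §2 The first-layer drop is at least `e = log₄ #Ш(E/ℚ)[2^∞]` on the K₄⁺ cut cell -/

/-- **`M₀ − M₁ ≥ e` ON THE K₄⁺ CUT CELL, mod Q2 ONLY.**  On gk2-p4 g29's K₄⁺ cut cell frame VERBATIM (as in this seat's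
`exists_selmerProfile_of_kFourPos_cut`): there is `e` with `1 ≤ e ≤ M₀`, `#Ш(E/ℚ)[2^∞] = 4^e`, and **a transposition-deep Kolyvagin prime `ℓ` (index `≥ 2`)
with a `d₁`-compatible datum of conductor `1·ℓ` such that `P(1·ℓ) ∉ 2^(M₀+1−e) E(K[1·ℓ])`** — the `2`-divisibility depth of the Kolyvagin system drops by
AT LEAST `e` at the first layer.  Proof: the profile (`#Sel_(2^e)(E/ℚ) = 4^e ≠ 4^(e−1) = #Sel_(2^(e−1))(E/ℚ)`) gives a class of `Ш(E/ℚ)` of order `2^e`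
(`exists_mem_sha_two_pow_smul_ne_zero_iff_natCard_selmerGroup_ne`), lifted to `Sel_(2^e)(E/ℚ)` (Kummer) and fed to §1 with `j = M₀ + 1 − e`.
K₄⁺ is the case `e = M₀` (`j = 1`).  BSD / K4Pos are NOT proved by this. [cite: McCallumLMS1991, §5 Thm. 5.4, Thm. 5.8] [cite: Kolyvagin1991MathAnn, Thm. 1]
[cite: Kolyvagin1989Izv, Thm. B₂] -/
theorem exists_transpositionDeep_notMem_two_pow_of_selmerProfile (hQ2 : KolyvaginRelationAtTwo)
    (W : WeierstrassCurve ℚ) [W.IsElliptic] [W.IsGloballyMinimal] [NeZero (W.conductorNorm ℤ)] (K : Type) [Field K] [NumberField K]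
    (hcm : ¬ W.HasCM)
    (hT : Odd W.tamagawaProduct) (v : HeightOneSpectrum (𝓞 ℚ)) (h2v : ((2 : ℕ) : 𝓞 ℚ) ∉ v.asIdeal)
    (hNv : ((W.conductorNorm ℤ : ℕ) : 𝓞 ℚ) ∈ v.asIdeal) (hmult : W.HasMultiplicativeReductionAt v) (hpos : 0 < W.Δ)
    (hIQ : IsImaginaryQuadratic K) (hodd : Odd (NumberField.discr K))
    (h3 : NumberField.discr K ≠ -3) (hHe : SatisfiesHeegnerHypothesis (W.conductorNorm ℤ) K)
    (hsq1 : ¬ IsSquare ((NumberField.discr K : ℚ) * -|W.Δ|)) (hsq2 : ¬ IsSquare ((NumberField.discr K : ℚ) * (-(2 * |W.Δ|))))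
    (hρ : ∀ n : ℕ, 0 < n → W.HasSurjectiveModNGaloisRep ((2 : ℤ) ^ n))
    (Dt : ModularParametrizationData W (W.conductorNorm ℤ)) (β : ℤ) (ι : K →+* ℂ) (d₁ : KolyvaginHeegnerData Dt β ι 1)
    (hy : ¬ IsOfFinAddOrder d₁.derivedPoint) (M₀ : ℕ)
    (hdiv : ∃ Q : (W.baseChange (ringClassField K ι 1)).toAffine.Point, ((2 ^ M₀ : ℕ) : ℤ) • Q = d₁.derivedPoint)
    (hndiv : ¬ ∃ Q : (W.baseChange (ringClassField K ι 1)).toAffine.Point, ((2 ^ (M₀ + 1) : ℕ) : ℤ) • Q = d₁.derivedPoint)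
    (Wd : WeierstrassCurve ℚ) [Wd.IsElliptic] (Cd : VariableChange ℚ) (hCd : Cd • W.quadraticTwist (discr K : ℚ) = Wd)
    (hSel : Nat.card (Wd.selmerGroup 2) = 2) (hDEF : padicValNat 2 Wd.tamagawaProduct = 0)
    (h4 : Nat.card (W.selmerGroup 2) = 4 ∧ ∃ c ∈ (W.kummerSelmerStructure ((2 : ℕ) : ℤ)).selmerGroup,
      galoisCohomology.localization (W.torsionGaloisModule ((2 : ℕ) : ℤ)) (Sum.inl Rat.infinitePlace) 1 c ≠ 0)
    (hr0 : W.analyticRank = 0) (h2K : ((Ideal.span {(2 : ℤ)}).primesOver (𝓞 K)).ncard = 2) {σ₀ : K ≃ₐ[ℚ] K} (hσ₀ : σ₀ ≠ 1) :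
    ∃ e : ℕ, 1 ≤ e ∧ e ≤ M₀ ∧ Nat.card (AddCommGroup.primaryComponent (↥W.sha) 2) = 4 ^ e ∧
      ∃ (ℓ : ℕ) (d : KolyvaginHeegnerData Dt β ι (1 * ℓ)),
        Zhang2014.IsKolyvaginPrime (W.conductorNorm ℤ) W K 2 ℓ ∧ 2 ≤ Zhang2014.kolyvaginIndex W 2 ℓ ∧
        (∃ (v : HeightOneSpectrum (𝓞 ℚ)) (𝔓 : Ideal (absIntegers (𝓞 ℚ) ℚ)) (h : absoluteGaloisGroup ℚ),
            (ℓ : 𝓞 ℚ) ∈ v.asIdeal ∧ 𝔓 ∈ v.primesAbove ∧ IsArithFrobAt (𝓞 ℚ) h 𝔓 ∧ ∃ u : geomTorsion W ((2 : ℕ) : ℤ), h • u ≠ u) ∧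
        (∀ s ∈ d₁.S, ∃ s' ∈ d.S, ∀ (x : ringClassField K ι 1) (x' : ringClassField K ι (1 * ℓ)),
            (x : ℂ) = x' → ((s' x' : ringClassField K ι (1 * ℓ)) : ℂ) = (s x : ℂ)) ∧
        (∀ (x : ringClassField K ι 1) (x' : ringClassField K ι (1 * ℓ)), (x : ℂ) = x' → d.emb x' = d₁.emb x) ∧
        ¬ ∃ Q : (W.baseChange (ringClassField K ι (1 * ℓ))).toAffine.Point, ((2 ^ (M₀ + 1 - e) : ℕ) : ℤ) • Q = d.derivedPoint := by
  haveI : Fact (Nat.Prime 2) := ⟨Nat.prime_two⟩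
  have hs2 : W.HasSurjectiveModNGaloisRep 2 := by simpa using hρ 1 one_pos
  have hw : W.rootNumber = 1 :=
    (Literature.Barriers.BirchSwinnertonDyer.even_analyticRank_iff_of_isNewformOf_conductorLevel Dt.isNewformOf).mp
      (by rw [hr0]; exact Even.zero)
  obtain ⟨hrk0, -⟩ := mordellWeilRank_eq_zero_and_finite_shaPrimary_rat_of_cut W K hQ2 hcm hT v h2v hNv hmult hIQ hodd h3 hHe hsq1 hsq2 hρ Dt β
    ι d₁ M₀ hndiv hw
  have h2t := forall_eq_zero_of_two_zsmul_eq_zero_of_natCard_torsionBy_two_eq_one W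
    (by convert natCard_torsionBy_point_two_eq_one_of_hasSurjectiveModNGaloisRep_two W hs2)
  obtain ⟨e, he1, heM, hYe, hprof⟩ := exists_selmerProfile_of_kFourPos_cut W K hQ2 hcm hT v h2v hNv hmult hpos hIQ hodd h3 hHe hsq1 hsq2 hρ Dt β
    ι d₁ hy M₀ hdiv hndiv Wd Cd hCd hSel hDEF h4 hr0 h2K hσ₀
  -- a class of `Ш(E/ℚ)` of order `2^e`: the `2^e`- and `2^(e−1)`-descents differ (`4^e ≠ 4^(e−1)`)
  have hneq : Nat.card (selmerGroup W ((2 ^ e : ℕ) : ℤ)) ≠ Nat.card (selmerGroup W ((2 ^ (e - 1) : ℕ) : ℤ)) := by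
    rw [hprof e, hprof (e - 1), min_self, min_eq_left (Nat.sub_le e 1)]
    intro h
    have := Nat.pow_right_injective (by norm_num : 2 ≤ 4) h
    omega
  obtain ⟨a, ha, hka, hne⟩ := (exists_mem_sha_two_pow_smul_ne_zero_iff_natCard_selmerGroup_ne W hrk0 h2t he1).mpr hneq
  -- lift it to `Sel_(2^e)(E/ℚ)` (Kummer)
  have hnz : ((2 ^ e : ℕ) : ℤ) ≠ 0 := by positivity
  have hmem : a ∈ W.sha ⊓ torsionBy W.galH1 ((2 ^ e : ℕ) : ℤ) :=
    AddSubgroup.mem_inf.mpr ⟨ha, by change ((2 ^ e : ℕ) : ℤ) • a = 0; exact hka⟩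
  rw [← WeierstrassCurve.map_torsionH1ToH1_selmerGroup_holds W hnz] at hmem
  obtain ⟨s₀, hs₀, rfl⟩ := AddSubgroup.mem_map.mp hmem
  -- `2^(M₀ − j) • s₀ ≠ 0` with `j = M₀ + 1 − e` (so `M₀ − j = e − 1`)
  have hj : M₀ - (M₀ + 1 - e) = e - 1 := by omega
  have hne' : ((2 ^ (M₀ - (M₀ + 1 - e)) : ℕ) : ℤ) • s₀ ≠ 0 := by
    rw [hj]
    exact fun h ↦ hne (by rw [← map_zsmul, h, map_zero])
  obtain ⟨ℓ, d, hkol, hidx, ⟨v', 𝔓, h, c₀, hℓv, h𝔓, hh, -, -, hhu, -⟩, hS, hemb, hwit⟩ :=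
    exists_transpositionDeep_notMem_two_pow_of_two_pow_sub_smul_ne_zero hQ2 W hcm hT v h2v hNv hmult K hIQ hodd h3 hHe hsq1 hsq2 hρ Dt β ι d₁ M₀
      hndiv hw e s₀ hs₀ (M₀ + 1 - e) (by omega) hne'
  exact ⟨e, he1, heM, hYe, ℓ, d, hkol, hidx, ⟨v', 𝔓, h, hℓv, h𝔓, hh, hhu⟩, hS, hemb, hwit⟩

/-! ## §3 Unconditionally the depth DROPS at the first layer (`M₁ < M₀`) -/

/-- **THE KOLYVAGIN DEPTH DROPS AT THE FIRST LAYER, mod Q2** — on K4Pos's cut frame (any cell with `#Sel₂(E) ≠ 1` suffices: here `#Sel₂(E) = 4`,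
`M₀ ≥ 1`): **some transposition-deep Kolyvagin prime `ℓ` (index `≥ 2`) carries a `d₁`-compatible datum with `P(1·ℓ) ∉ 2^(M₀) E(K[1·ℓ])`**, although
`2^(M₀) ∣ P(1)` — §1 with `j = M₀` and ANY non-zero class of `Sel₂(E/ℚ)`.  (K₄⁺ asks for `P(ℓ) ∉ 2E(K[ℓ])`, i.e. the full drop `j = 1`.)  Any sign of `Δ`.
BSD / K4Pos are NOT proved by this. [cite: McCallumLMS1991, §5 Thm. 5.4] [cite: Kolyvagin1989Izv, Thm. B₂] -/
theorem exists_transpositionDeep_notMem_two_pow_depth_of_natCard_selmerGroup_two_eq_four (hQ2 : KolyvaginRelationAtTwo)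
    (W : WeierstrassCurve ℚ) [W.IsElliptic] [W.IsGloballyMinimal] [NeZero (W.conductorNorm ℤ)] (hcm : ¬ W.HasCM)
    (hT : Odd W.tamagawaProduct) (h4 : Nat.card (W.selmerGroup 2) = 4)
    (v : HeightOneSpectrum (𝓞 ℚ)) (h2v : ((2 : ℕ) : 𝓞 ℚ) ∉ v.asIdeal)
    (hNv : ((W.conductorNorm ℤ : ℕ) : 𝓞 ℚ) ∈ v.asIdeal) (hmult : W.HasMultiplicativeReductionAt v)
    (K : Type) [Field K] [NumberField K] (hIQ : IsImaginaryQuadratic K) (hodd : Odd (NumberField.discr K))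
    (h3 : NumberField.discr K ≠ -3) (hHe : SatisfiesHeegnerHypothesis (W.conductorNorm ℤ) K)
    (hsq1 : ¬ IsSquare ((NumberField.discr K : ℚ) * -|W.Δ|)) (hsq2 : ¬ IsSquare ((NumberField.discr K : ℚ) * (-(2 * |W.Δ|))))
    (hρ : ∀ n : ℕ, 0 < n → W.HasSurjectiveModNGaloisRep ((2 : ℤ) ^ n))
    (Dt : ModularParametrizationData W (W.conductorNorm ℤ)) (β : ℤ) (ι : K →+* ℂ) (d₁ : KolyvaginHeegnerData Dt β ι 1) (M₀ : ℕ) (hM₀ : 1 ≤ M₀)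
    (hndiv : ¬ ∃ Q : (W.baseChange (ringClassField K ι 1)).toAffine.Point, ((2 ^ (M₀ + 1) : ℕ) : ℤ) • Q = d₁.derivedPoint)
    (hw1 : W.rootNumber = 1) :
    ∃ (ℓ : ℕ) (d : KolyvaginHeegnerData Dt β ι (1 * ℓ)),
      Zhang2014.IsKolyvaginPrime (W.conductorNorm ℤ) W K 2 ℓ ∧ 2 ≤ Zhang2014.kolyvaginIndex W 2 ℓ ∧
      (∃ (v : HeightOneSpectrum (𝓞 ℚ)) (𝔓 : Ideal (absIntegers (𝓞 ℚ) ℚ)) (h : absoluteGaloisGroup ℚ),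
          (ℓ : 𝓞 ℚ) ∈ v.asIdeal ∧ 𝔓 ∈ v.primesAbove ∧ IsArithFrobAt (𝓞 ℚ) h 𝔓 ∧ ∃ u : geomTorsion W ((2 : ℕ) : ℤ), h • u ≠ u) ∧
      (∀ s ∈ d₁.S, ∃ s' ∈ d.S, ∀ (x : ringClassField K ι 1) (x' : ringClassField K ι (1 * ℓ)),
          (x : ℂ) = x' → ((s' x' : ringClassField K ι (1 * ℓ)) : ℂ) = (s x : ℂ)) ∧
      (∀ (x : ringClassField K ι 1) (x' : ringClassField K ι (1 * ℓ)), (x : ℂ) = x' → d.emb x' = d₁.emb x) ∧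
      ¬ ∃ Q : (W.baseChange (ringClassField K ι (1 * ℓ))).toAffine.Point, ((2 ^ M₀ : ℕ) : ℤ) • Q = d.derivedPoint := by
  -- a non-zero class of `Sel₂(E/ℚ)`
  have e21 : ((2 ^ 1 : ℕ) : ℤ) = 2 := by norm_num
  have h4' : Nat.card (selmerGroup W ((2 ^ 1 : ℕ) : ℤ)) = 4 := by rw [e21]; exact h4
  haveI : Finite (selmerGroup W ((2 ^ 1 : ℕ) : ℤ)) := Nat.finite_of_card_ne_zero (by rw [h4']; norm_num)
  have hnt : Nontrivial (selmerGroup W ((2 ^ 1 : ℕ) : ℤ)) := Finite.one_lt_card_iff_nontrivial.mp (by rw [h4']; norm_num)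
  obtain ⟨⟨s₀, hs₀⟩, hs0⟩ := exists_ne (0 : selmerGroup W ((2 ^ 1 : ℕ) : ℤ))
  have hne : ((2 ^ (M₀ - M₀) : ℕ) : ℤ) • s₀ ≠ 0 := by
    rw [Nat.sub_self, pow_zero, Nat.cast_one, one_zsmul]
    exact fun h ↦ hs0 (Subtype.ext h)
  obtain ⟨ℓ, d, hkol, hidx, ⟨v', 𝔓, h, c₀, hℓv, h𝔓, hh, -, -, hhu, -⟩, hS, hemb, hwit⟩ :=
    exists_transpositionDeep_notMem_two_pow_of_two_pow_sub_smul_ne_zero hQ2 W hcm hT v h2v hNv hmult K hIQ hodd h3 hHe hsq1 hsq2 hρ Dt β ι d₁ M₀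
      hndiv hw1 1 s₀ hs₀ M₀ hM₀ hne
  exact ⟨ℓ, d, hkol, hidx, ⟨v', 𝔓, h, hℓv, h𝔓, hh, hhu⟩, hS, hemb, hwit⟩

end Summit.BirchSwinnertonDyer.BirchSwinnertonDyer.Theorems.GenusExact.PlusDescent

end
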